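import Mathlib
import HarnessLib
import Summits.QuantumAdvantage.QuantumAdvantage.Theorems.PumpDialB

/-!
# PumpDial, part C (sections Restrict, Node, Calibration, Degree) — support for item stmt-QuantumAdvantage-28487

Cell decomp-qadv, seat lens-4 («minimal counterexample / extremal reduction»), generation 25 — land port of the node
«PumpDial» (published under the cell's HOME/decomp-qadv-lens-4/g25/PumpDial.lean rev 3, sha256 59c460875773e61d…, record NODE-g25.md;
RESIDUAL MODE on AbsorptionDial:28487 `NoPerfectPolyOdd`).  The node file with ONLY the namespace renamed
`Theses.PumpDial → Theorems.PumpDial`, `example`s dropped and one-line docstrings added where missing, cut into chain-imported parts;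
the X-side junction theorems (conclusion `AbsorptionDial.NoPerfectPolyOdd` BY NAME) live in the LAST part, the only one importing
`Theses.AbsorptionDial`; every other part imports only `AdviceFreeQNC0.*`, `Literature.Computability.MetaComplexity.*`, HarnessLib, Mathlib
(no import path to any Theses file — checked on the tree's import lines), so route items can be typed BY NAME over these parts.
No `sorry`, no new axioms, no instances, no notation.

This part: `hard_of_perfAt` … `cpl_zero` (46 declarations).
-/

set_option autoImplicit false
set_option linter.dupNamespace false

noncomputable section

namespace Summit.QuantumAdvantage.QuantumAdvantage.Theorems.PumpDial
open Classical
open Finset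
open Summit.QuantumAdvantage.AdviceFreeQNC0
open Summit.QuantumAdvantage.AdviceFreeQNC0.TwoShot
open Summit.QuantumAdvantage.AdviceFreeQNC0.CharK
open Literature.Computability.MetaComplexity Literature.Computability.MetaComplexity.Smolensky

section Restrict

variable {n : ℕ}

/-- **LAW (PROVED): every perfect board reaches an ODD DIAGONAL board of length `n' ∈ {n−1, n, n+1}` at degree
`≤ 4d+1`.**  Odd diagonal: stay.  Even off-diagonal: climb (`d+1`, `n+1`).  Odd off-diagonal: restrict + climb
(`2d+1`, same `n`).  Even diagonal: restrict to the odd off-diagonal board below, then restrict + climb there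
(`4d+1`, `n−1`).  Hence `X ⟺ X restricted to odd diagonal boards` (`target_iff_hard`). -/
theorem hard_of_perfAt {p : ℕ} [Fact p.Prime] {n c d : ℕ} (hn : 4 ≤ n) (hP : PerfAt p n c d) :
    ∃ n' c', (n' = n - 1 ∨ n' = n ∨ n' = n + 1) ∧ (n' % 2 = 1 ∧ c' % 3 = n' % 3) ∧ PerfAt p n' c' (4 * d + 1) := by
  have hmono : ∀ {m e k}, k ≤ 4 * d + 1 → PerfAt p m e k → PerfAt p m e (4 * d + 1) := fun hk h => perfAt_mono hk h
  rcases Nat.even_or_odd n with he | ho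
  · have hn2 : n % 2 = 0 := Nat.even_iff.mp he
    by_cases hc : c % 3 = n % 3
    · -- even diagonal: n = m + 1, m odd ≥ 3; restrict (b = 0) to (m, c+1), odd off-diagonal; then same-length diag.
      obtain ⟨m, rfl⟩ : ∃ m, n = m + 1 := ⟨n - 1, by omega⟩
      have hQ := perfAt_restrict_diag hP (by omega) false
      simp only [Bool.toNat_false, mul_zero, add_zero] at hQ
      obtain ⟨k, rfl⟩ : ∃ k, m = k + 1 := ⟨m - 1, by omega⟩
      obtain ⟨c', hc', hR⟩ := diag_of_offdiag_sameLen (by omega) hQ (by omega)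
      exact ⟨k + 1, c', Or.inl (by omega), ⟨by omega, hc'⟩, hmono (by omega) hR⟩
    · -- even off-diagonal: climb.
      obtain ⟨c', hc', hR⟩ := climb_of_offdiag hP hc
      exact ⟨n + 1, c', Or.inr (Or.inr rfl), ⟨by omega, hc'⟩, hmono (by omega) hR⟩
  · have hn2 : n % 2 = 1 := Nat.odd_iff.mp ho
    by_cases hc : c % 3 = n % 3
    · exact ⟨n, c, Or.inr (Or.inl rfl), ⟨hn2, hc⟩, hmono (by omega) hP⟩
    · -- odd off-diagonal: n = m + 1, restrict + climb at the same length.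
      obtain ⟨m, rfl⟩ : ∃ m, n = m + 1 := ⟨n - 1, by omega⟩
      obtain ⟨c', hc', hR⟩ := diag_of_offdiag_sameLen (by omega) hP hc
      exact ⟨m + 1, c', Or.inr (Or.inl rfl), ⟨hn2, hc'⟩, hmono (by omega) hR⟩

/-- polylog bookkeeping for the transfer: `4·(log₂ n)^C + 1 ≤ (log₂ n')^(2C+3)` when `16 ≤ n ≤ n' + 1`. -/
theorem polylog_bump {n n' C : ℕ} (hn : 16 ≤ n) (h : n ≤ n' + 1) :
    4 * (Nat.log 2 n) ^ C + 1 ≤ (Nat.log 2 n') ^ (2 * C + 3) := by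
  have hL' : 3 ≤ Nat.log 2 n' := Nat.le_log_of_pow_le (by norm_num) (by omega)
  have hLL : Nat.log 2 n ≤ Nat.log 2 n' + 1 := by
    calc Nat.log 2 n ≤ Nat.log 2 (n' * 2) := Nat.log_mono_right (by omega)
      _ = Nat.log 2 n' + 1 := Nat.log_mul_base (by norm_num) (by omega)
  have hL2 : Nat.log 2 n ≤ 2 * Nat.log 2 n' := by omega
  have h3 : 2 ^ (C + 2) + 1 ≤ (Nat.log 2 n') ^ (C + 3) := by
    calc 2 ^ (C + 2) + 1 ≤ 2 ^ (C + 2) + 2 ^ (C + 2) := by have := @Nat.one_le_two_pow (C + 2); omega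
      _ = 2 ^ (C + 3) := by ring
      _ ≤ (Nat.log 2 n') ^ (C + 3) := Nat.pow_le_pow_left (by omega) _
  have h1 : 1 ≤ (Nat.log 2 n') ^ C := Nat.one_le_pow _ _ (by omega)
  calc 4 * (Nat.log 2 n) ^ C + 1 ≤ 4 * (2 * Nat.log 2 n') ^ C + 1 := by
        have := Nat.pow_le_pow_left hL2 C; omega
    _ = 2 ^ (C + 2) * (Nat.log 2 n') ^ C + 1 := by rw [mul_pow]; ring
    _ ≤ 2 ^ (C + 2) * (Nat.log 2 n') ^ C + (Nat.log 2 n') ^ C := by omega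
    _ = (2 ^ (C + 2) + 1) * (Nat.log 2 n') ^ C := by ring
    _ ≤ (Nat.log 2 n') ^ (C + 3) * (Nat.log 2 n') ^ C := Nat.mul_le_mul_right _ h3
    _ = (Nat.log 2 n') ^ (2 * C + 3) := by rw [← pow_add]; ring_nf

end Restrict

section Node


/-- the HARD board class: ODD length, DIAGONAL charge (`c ≡ n (mod 3)`).  By the §4b LAW these boards decide `X`
(`target_iff_hard`); by the data of NODE-g24.md §3 they (with the even off-diagonal boards) are exactly the boards
carrying NO low-degree K-linear unity — odd off-diagonal boards carry a universal degree-1 unity, even diagonal ones a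
degree-2 unity, so there every K-linear method is walled. -/
def HardBoard (n c : ℕ) : Prop := n % 2 = 1 ∧ c % 3 = n % 3

/-- `X` restricted to hard boards. -/
def NoPerfectPolyHardOdd : Prop :=
  ∀ (p : ℕ) [Fact p.Prime], 5 ≤ p → ∀ C : ℕ, ∃ n₀ : ℕ, ∀ n ≥ n₀, ∀ c : ℕ, HardBoard n c →
    ∀ y : Strat n, (∀ g, HasDegF p (y g) ((Nat.log 2 n) ^ C)) → ∃ u, ringWinU c y u = false

/-- `X ⟺ X on DIAGONAL boards` (from the §4 LAW): the diagonal boards decide the target. -/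
def NoPerfectPolyDiagOdd : Prop :=
  ∀ (p : ℕ) [Fact p.Prime], 5 ≤ p → ∀ C : ℕ, ∃ n₀ : ℕ, ∀ n ≥ n₀, ∀ c : ℕ, c % 3 = n % 3 →
    ∀ y : Strat n, (∀ g, HasDegF p (y g) ((Nat.log 2 n) ^ C)) → ∃ u, ringWinU c y u = false

/-! ### The K-linear pieces -/

/-- single-prime form of piece `B_K`. -/
def NoUnityHardAt (p : ℕ) [Fact p.Prime] : Prop :=
  ∀ C : ℕ, ∃ n₀ : ℕ, ∀ n ≥ n₀, ∀ c : ℕ, HardBoard n c → ¬ UnityAt (ZMod p) n c ((Nat.log 2 n) ^ C)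

/-- **piece `B_K = NoUnityHardOdd`** [crux · pure LINEAR ALGEBRA over `𝔽_p` (for each `(n, c, d)` a finite linear
system) · NOT implied by `X` (a unity is `K`-valued) but implying the `X`-implied Boolean piece `B = NoOneLiveHardOdd`
(`noOneLiveHard_of_noUnityHard`) — it is the ATTACK on `B` · UNDECIDED · INSTRUMENTABLE exactly (`data/unity_lin.py`,
census K34: `d_K(9) = 4`, `d_K(10), d_K(11) ≥ 4`) · FALSE at `p = 3` (`not_noUnityHardAt_three`) and FALSE on the
complementary board classes for every `p` (universal low-degree unities, NODE-g24.md §3)]: for `p ≥ 5` and every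
`C`, on all large odd diagonal boards there is NO K-linear unity of degree `(log₂ n)^C`. -/
def NoUnityHardOdd : Prop := ∀ (p : ℕ) [Fact p.Prime], 5 ≤ p → NoUnityHardAt p

/-- single-prime form of piece `A_K`. -/
def HardToUnityAt (p : ℕ) [Fact p.Prime] : Prop :=
  ∀ C : ℕ, ∃ C' n₀ : ℕ, ∀ n ≥ n₀, ∀ c : ℕ, HardBoard n c → PerfAt p n c ((Nat.log 2 n) ^ C) →
    UnityAt (ZMod p) n c ((Nat.log 2 n) ^ C')

/-- **piece `A_K = HardToUnityOdd`** [crux · SAME-BOARD TIE (same `n`, same `c`) with a K-LINEAR conclusion · implied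
by `X` vacuously (`aK_of_target`) and by the Boolean piece `A` (`hardToUnity_of_hardToOneLive`) · UNDECIDED /
IDEA-NEEDED · holds at `p = 3` (`hardToUnityAt_three`) · NOT derivable from `¬B_K` (probe: `¬B_K` gives unities on
SOME large hard boards, `A_K` needs one on EVERY perfect hard board)]: for `p ≥ 5`, a PERFECT polylog-degree Boolean
strategy on an odd diagonal board forces a polylog-degree K-linear unity ON THAT BOARD. -/
def HardToUnityOdd : Prop := ∀ (p : ℕ) [Fact p.Prime], 5 ≤ p → HardToUnityAt p

/-! ### The Boolean pieces (the one-live normal form, tied to the SAME board) -/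

/-- single-prime form of piece `B`. -/
def NoOneLiveHardAt (p : ℕ) [Fact p.Prime] : Prop :=
  ∀ C : ℕ, ∃ n₀ : ℕ, ∀ n ≥ n₀, ∀ c : ℕ, HardBoard n c → ∀ y : Strat n,
    (∀ g, HasDegF p (y g) ((Nat.log 2 n) ^ C)) → ∃ u, liveCount c y u ≠ 1

/-- **piece `B = NoOneLiveHardOdd`** [crux · WEAKER than `X` by restriction (`b_of_target`) · OPEN · ATTACKABLE through
`B_K` (linear algebra; `noOneLiveHard_of_noUnityHard`) and through g23's exact residue law (one-live ⟹ `2·S ≡ 3 (mod p)`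
everywhere) · FALSE at `p = 3` (`not_noOneLiveHardAt_three`)]: for `p ≥ 5`, polylog degree, on all large odd diagonal
boards NO strategy fires exactly one live cut on every input. -/
def NoOneLiveHardOdd : Prop := ∀ (p : ℕ) [Fact p.Prime], 5 ≤ p → NoOneLiveHardAt p

/-- single-prime form of piece `A`. -/
def HardToOneLiveAt (p : ℕ) [Fact p.Prime] : Prop :=
  ∀ C : ℕ, ∃ C' n₀ : ℕ, ∀ n ≥ n₀, ∀ c : ℕ, HardBoard n c → PerfAt p n c ((Nat.log 2 n) ^ C) →
    ∃ y' : Strat n, OneLive c y' ∧ ∀ g, HasDegF p (y' g) ((Nat.log 2 n) ^ C')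

/-- **piece `A = HardToOneLiveOdd`** [crux · the one-live NORMAL FORM tied to the SAME BOARD (answer to OBJECTION 66v41
(b): `n' = n`, `c' = c`) · WEAKER than `X` (vacuously, `a_of_target`) · holds at `p = 3` (`hardToOneLiveAt_three`) ·
UNDECIDED / IDEA-NEEDED · NOT derivable from `¬B` (io witnesses vs. every perfect board; probe) — but, HONESTLY, implied
outright by «every large hard board carries SOME one-live polylog strategy» (`tied_collapse`: no reduction with an
existential conclusion can do better, §2 WALL)]: for `p ≥ 5`, a perfect polylog-degree strategy on an odd diagonal board
forces a one-live polylog-degree strategy on that board. -/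
def HardToOneLiveOdd : Prop := ∀ (p : ℕ) [Fact p.Prime], 5 ≤ p → HardToOneLiveAt p

/-! ### The lattice: `A ⟹ A_K`, `B_K ⟹ B` (LAW one-live ⟹ unity) -/

/-- `hardToUnity_of_hardToOneLive` (PumpDial g25, section Node). -/
theorem hardToUnity_of_hardToOneLive {p : ℕ} [Fact p.Prime] (h : HardToOneLiveAt p) : HardToUnityAt p := by
  intro C
  obtain ⟨C', n₀, h₀⟩ := h C
  refine ⟨C', n₀, fun n hn c hH hP => ?_⟩
  obtain ⟨y', h1, hdeg⟩ := h₀ n hn c hH hP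
  exact unity_of_oneLive (ZMod p) hdeg h1

/-- `noOneLiveHard_of_noUnityHard` (PumpDial g25, section Node). -/
theorem noOneLiveHard_of_noUnityHard {p : ℕ} [Fact p.Prime] (h : NoUnityHardAt p) : NoOneLiveHardAt p := by
  intro C
  obtain ⟨n₀, hn₀⟩ := h C
  exact ⟨n₀, fun n hn c hH y hy => not_oneLive_of_not_unity (hn₀ n hn c hH) y hy⟩

/-- `bK_imp_b` (PumpDial g25, section Node). -/
theorem bK_imp_b : NoUnityHardOdd → NoOneLiveHardOdd := fun h p _ hp => noOneLiveHard_of_noUnityHard (h p hp)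

/-- `a_imp_aK` (PumpDial g25, section Node). -/
theorem a_imp_aK : HardToOneLiveOdd → HardToUnityOdd := fun h p _ hp => hardToUnity_of_hardToOneLive (h p hp)

/-! ### Why no tie inside the game's algebra can do better (the §2 WALL, applied) -/

/-- THE DEGREE-TIED Boolean reduction on the SAME board with a degree budget `F`. -/
def OneLiveReductionTied (p : ℕ) [Fact p.Prime] (F : ℕ → ℕ) : Prop :=
  ∀ n c d, ∀ y : Strat n, Perfect c y → (∀ g, HasDegF p (y g) d) →
    ∃ y' : Strat n, OneLive c y' ∧ ∀ g, HasDegF p (y' g) (F d)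

/-- the COSET-TIED reduction: the normal form must moreover be reached from `y` by XOR-ing a NULL strategy of degree
`≤ F d` (the strongest tie expressible inside the game's own `𝔽₂`-linear algebra). -/
def OneLiveCosetReduction (p : ℕ) [Fact p.Prime] (F : ℕ → ℕ) : Prop :=
  ∀ n c d, ∀ y : Strat n, Perfect c y → (∀ g, HasDegF p (y g) d) →
    ∃ z : Strat n, Null c z ∧ (∀ g, HasDegF p (z g) (F d)) ∧ OneLive c (bxorS y z)

/-- COLLAPSE I: a same-board reduction with an existential conclusion is implied outright by the EXISTENCE of one-live
strategies of degree `e ≤ F d` on every perfect board. -/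
theorem tied_collapse {p : ℕ} [Fact p.Prime] {F : ℕ → ℕ} {e : ℕ} (hF : ∀ d, e ≤ F d)
    (hex : ∀ n c d, PerfAt p n c d → ∃ y' : Strat n, OneLive c y' ∧ ∀ g, HasDegF p (y' g) e) :
    OneLiveReductionTied p F := by
  intro n c d y hy hdeg
  obtain ⟨y', h1, h2⟩ := hex n c d ⟨y, hy, hdeg⟩
  exact ⟨y', h1, fun g => lowDeg_mono (hF d) (h2 g)⟩

/-- COLLAPSE II (the wall applied): the same existence hypothesis gives even the COSET-TIED reduction for any budget
`F(d) ≥ d + e` — XOR a null strategy; no mathematics about the given `y`.  Typing the tie by a degree budget therefore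
cannot rescue g23's reduction from OBJECTION 66v41; the board tie (§4b) and the passage to a K-linear conclusion (§3) are
what this node adds instead. -/
theorem coset_collapse {p : ℕ} [Fact p.Prime] {F : ℕ → ℕ} {e : ℕ} (hF : ∀ d, d + e ≤ F d)
    (hex : ∀ n c d, PerfAt p n c d → ∃ y' : Strat n, OneLive c y' ∧ ∀ g, HasDegF p (y' g) e) :
    OneLiveCosetReduction p F := by
  intro n c d y hy hdeg
  obtain ⟨y', h1, h2⟩ := hex n c d ⟨y, hy, hdeg⟩
  obtain ⟨z, hz, hzdeg, hN, _⟩ := wall (p := p) (OneLive c) ⟨y', h1, perfect_of_oneLive h1, h2⟩ y hy hdeg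
  exact ⟨z, hz, fun g => lowDeg_mono (hF d) (hzdeg g), hN⟩

/-! ### The dual (constructive) piece: DESIGNS on hard boards -/

/-- single-prime form of piece `B_D`. -/
def DesignsHardAt (p : ℕ) [Fact p.Prime] : Prop :=
  ∀ C : ℕ, ∃ n₀ : ℕ, ∀ n ≥ n₀, ∀ c : ℕ, HardBoard n c → DesignAt (ZMod p) n c ((Nat.log 2 n) ^ C)

/-- **piece `B_D = DesignsHardOdd`** [crux · CONSTRUCTIVE / «certificate by dual witness»: EXHIBIT, on every large odd
diagonal board, an `𝔽_p`-linear functional `D` on input functions with `D 1 = 1` killing all degree-`(log₂ n)^C`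
multiples of the `n + 1` liveness indicators · EXACTLY EQUIVALENT to `B_K` (`designsHard_iff_noUnityHard`, finite-dim
duality) · the proof-complexity DESIGN METHOD is the named tool (Krajíček §16.1; BIKPRS design amplification
`d ↦ 2d+1, n ↦ 5n` for `Count₃`, L.16.1.4; explicit char-0 weights, L.16.1.5) · INSTRUMENTABLE: small designs are the
left kernel of the unity matrix (census K34 asks for their structure) · FALSE at `p = 3`]. -/
def DesignsHardOdd : Prop := ∀ (p : ℕ) [Fact p.Prime], 5 ≤ p → DesignsHardAt p

/-- `designsHardAt_iff` (PumpDial g25, section Node). -/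
theorem designsHardAt_iff (p : ℕ) [Fact p.Prime] : DesignsHardAt p ↔ NoUnityHardAt p := by
  unfold DesignsHardAt NoUnityHardAt
  simp only [designAt_iff_not_unityAt]

/-- `designsHard_iff_noUnityHard` (PumpDial g25, section Node). -/
theorem designsHard_iff_noUnityHard : DesignsHardOdd ↔ NoUnityHardOdd :=
  ⟨fun h p _ hp => (designsHardAt_iff p).mp (h p hp), fun h p _ hp => (designsHardAt_iff p).mpr (h p hp)⟩

end Node

section Calibration


/-! ## §6 Calibration at `p = 3` (the dial's threshold is the tree's `3 | 5`) -/

/-- at `p = 3` EVERY board of length `≥ 1` carries a one-live strategy of degree `2` (tree `walkEasyThree_oneShot`). -/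
theorem oneLive_three (n c : ℕ) (hn : 1 ≤ n) : ∃ y : Strat n, OneLive c y ∧ ∀ g, HasDegF 3 (y g) 2 := by
  obtain ⟨y, hdeg, hshots, hwin⟩ := walkEasyThree_oneShot c n hn
  exact ⟨y, fun u => liveCount_eq_one_of_win_of_shots_le_one (hwin u) (hshots u), hdeg⟩

/-- … hence a degree-`2` unity. -/
theorem unityAt_three (n c : ℕ) (hn : 1 ≤ n) : UnityAt (ZMod 3) n c 2 := by
  obtain ⟨y, h1, hdeg⟩ := oneLive_three n c hn
  exact unity_of_oneLive (ZMod 3) hdeg h1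

/-- `two_le_log` (PumpDial g25, section Calibration). -/
private theorem two_le_log {m : ℕ} (hm : 4 ≤ m) : 2 ≤ (Nat.log 2 m) ^ 1 := by
  rw [pow_one]; exact Nat.le_log_of_pow_le (by norm_num) (by omega)

/-- **`B` and `B_K` FAIL at `p = 3`** (as they must: `closes` would otherwise prove the false `X(3)`). -/
theorem not_noOneLiveHardAt_three : ¬ NoOneLiveHardAt 3 := by
  intro h
  obtain ⟨n₀, hn₀⟩ := h 1
  have hH : HardBoard (6 * n₀ + 9) 0 := by unfold HardBoard; omega
  obtain ⟨y, h1, hdeg⟩ := oneLive_three (6 * n₀ + 9) 0 (by omega)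
  obtain ⟨u, hu⟩ := hn₀ (6 * n₀ + 9) (by omega) 0 hH y fun g => lowDeg_mono (two_le_log (by omega)) (hdeg g)
  exact hu (h1 u)

/-- `not_noUnityHardAt_three` (PumpDial g25, section Calibration). -/
theorem not_noUnityHardAt_three : ¬ NoUnityHardAt 3 := fun h =>
  not_noOneLiveHardAt_three (noOneLiveHard_of_noUnityHard h)

/-- **`A` and `A_K` HOLD at `p = 3`** (one-live strategies exist on every board). -/
theorem hardToOneLiveAt_three : HardToOneLiveAt 3 := by
  intro C
  refine ⟨1, 4, fun n hn c _ _ => ?_⟩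
  obtain ⟨y, h1, hdeg⟩ := oneLive_three n c (by omega)
  exact ⟨y, h1, fun g => lowDeg_mono (two_le_log hn) (hdeg g)⟩

/-- `hardToUnityAt_three` (PumpDial g25, section Calibration). -/
theorem hardToUnityAt_three : HardToUnityAt 3 := hardToUnity_of_hardToOneLive hardToOneLiveAt_three

/-- `not_designsHardAt_three` (PumpDial g25, section Calibration). -/
theorem not_designsHardAt_three : ¬ DesignsHardAt 3 := fun h =>
  not_noUnityHardAt_three ((designsHardAt_iff 3).mp h)

end Calibration

section Degree

variable {K : Type*} [Field K] {n : ℕ}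

/-! # PART II — generation 25: the UNITY board calculus, the staircase, the pump -/
/-! ## §8 Degree bookkeeping over a general field `K` -/

/-- `const_mem_lowDeg` (PumpDial g25, section Degree). -/
theorem const_mem_lowDeg (a : K) (d : ℕ) : (fun _ : Fin n → Bool => a) ∈ lowDeg K n d := by
  have e : (fun _ : Fin n → Bool => a) = a • mono K (∅ : Finset (Fin n)) := by
    funext u; simp
  rw [e]; exact Submodule.smul_mem _ a (mono_mem_lowDeg (by simp))

/-- `indicator_mem_lowDeg_one` (PumpDial g25, section Degree). -/
theorem indicator_mem_lowDeg_one (i : Fin n) :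
    (fun u : Fin n → Bool => if u i = true then (1 : K) else 0) ∈ lowDeg K n 1 := by
  have e : (fun u : Fin n → Bool => if u i = true then (1 : K) else 0) = mono K {i} := by
    funext u; simp only [mono_apply, Finset.mem_singleton, forall_eq]
  rw [e]; exact mono_mem_lowDeg (by simp)

/-- `one_sub_indicator_mem_lowDeg_one` (PumpDial g25, section Degree). -/
theorem one_sub_indicator_mem_lowDeg_one (i : Fin n) :
    (fun u : Fin n → Bool => 1 - (if u i = true then (1 : K) else 0)) ∈ lowDeg K n 1 := by
  have e : (fun u : Fin n → Bool => 1 - (if u i = true then (1 : K) else 0)) =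
      (fun _ => (1 : K)) - fun u => if u i = true then (1 : K) else 0 := by
    funext u; simp only [Pi.sub_apply]
  rw [e]; exact Submodule.sub_mem _ (const_mem_lowDeg 1 1) (indicator_mem_lowDeg_one i)

/-- composition with `v ↦ b :: v` (fix the first bit) does not raise the degree. -/
theorem cons_comp_mem_lowDeg (b : Bool) {d : ℕ} {P : CubeFn K (n + 1)} (hP : P ∈ lowDeg K (n + 1) d) :
    (fun v : Fin n → Bool => P (Fin.cons b v)) ∈ lowDeg K n d := by
  refine AdviceFreeQNC0.comp_mem_lowDeg_of_coord (F := K)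
    (fun v : Fin n → Bool => (Fin.cons b v : Fin (n + 1) → Bool)) (fun i => ?_) hP
  refine Fin.cases ?_ (fun j => ?_) i
  · simp only [Fin.cons_zero]
    cases b
    · have e : (fun _ : Fin n → Bool => if false = true then (1 : K) else 0) = fun _ => (0 : K) := by
        funext; simp
      rw [e]; exact const_mem_lowDeg 0 1
    · have e : (fun _ : Fin n → Bool => if true = true then (1 : K) else 0) = fun _ => (1 : K) := by
        funext; simp
      rw [e]; exact const_mem_lowDeg 1 1
  · have e : (fun v : Fin n → Bool =>
        if (Fin.cons b v : Fin (n + 1) → Bool) j.succ = true then (1 : K) else 0) = mono K {j} := by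
      funext v; simp only [Fin.cons_succ, mono_apply, Finset.mem_singleton, forall_eq]
    rw [e]; exact mono_mem_lowDeg (by simp)

/-- composition with `u ↦ tail u` (ignore the first bit) does not raise the degree. -/
theorem tail_comp_mem_lowDeg {d : ℕ} {P : CubeFn K n} (hP : P ∈ lowDeg K n d) :
    (fun u : Fin (n + 1) → Bool => P (Fin.tail u)) ∈ lowDeg K (n + 1) d := by
  refine AdviceFreeQNC0.comp_mem_lowDeg_of_coord (F := K) (fun u : Fin (n + 1) → Bool => Fin.tail u)
    (fun i => ?_) hP
  have e : (fun u : Fin (n + 1) → Bool => if Fin.tail u i = true then (1 : K) else 0) =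
      mono K {i.succ} := by
    funext u; simp only [mono_apply, Finset.mem_singleton, forall_eq]; rfl
  rw [e]; exact mono_mem_lowDeg (by simp)

/-- the complement pull-back `P ↦ P ∘ (u ↦ ¬u)`. -/
def cpl (P : CubeFn K n) : CubeFn K n := fun u => P (fun i => !(u i))

omit [Field K] in

/-- `cpl_apply` (PumpDial g25, section Degree). -/
theorem cpl_apply (P : CubeFn K n) (u : Fin n → Bool) : cpl P u = P (fun i => !(u i)) := rfl

/-- `cpl_mem_lowDeg` (PumpDial g25, section Degree). -/
theorem cpl_mem_lowDeg {d : ℕ} {P : CubeFn K n} (hP : P ∈ lowDeg K n d) : cpl P ∈ lowDeg K n d := by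
  refine AdviceFreeQNC0.comp_mem_lowDeg_of_coord (F := K) (fun u : Fin n → Bool => fun i => !(u i))
    (fun i => ?_) hP
  have e : (fun u : Fin n → Bool => if (!(u i)) = true then (1 : K) else 0) = 1 - mono K {i} := by
    funext u
    simp only [Pi.sub_apply, Pi.one_apply, mono_apply, Finset.mem_singleton, forall_eq]
    rcases Bool.eq_false_or_eq_true (u i) with hb | hb <;> simp [hb]
  rw [e]
  exact Submodule.sub_mem _ (by rw [← mono_empty]; exact mono_mem_lowDeg (by simp)) (mono_mem_lowDeg (by simp))

/-- `cpl_mono_singleton` (PumpDial g25, section Degree). -/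
theorem cpl_mono_singleton (a : Fin n) : cpl (mono K {a}) = 1 - mono K {a} := by
  funext u
  simp only [cpl_apply, Pi.sub_apply, Pi.one_apply, mono_apply, Finset.mem_singleton, forall_eq]
  rcases Bool.eq_false_or_eq_true (u a) with hb | hb <;> simp [hb]

/-- `cpl_mul` (PumpDial g25, section Degree). -/
theorem cpl_mul (P Q : CubeFn K n) : cpl (P * Q) = cpl P * cpl Q := rfl

/-- `cpl_add` (PumpDial g25, section Degree). -/
theorem cpl_add (P Q : CubeFn K n) : cpl (P + Q) = cpl P + cpl Q := rfl

/-- `cpl_smul` (PumpDial g25, section Degree). -/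
theorem cpl_smul (a : K) (P : CubeFn K n) : cpl (a • P) = a • cpl P := rfl

/-- `cpl_zero` (PumpDial g25, section Degree). -/
theorem cpl_zero : cpl (0 : CubeFn K n) = 0 := rfl

end Degree

end Summit.QuantumAdvantage.QuantumAdvantage.Theorems.PumpDial
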